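import Mathlib
import Summits.NavierStokesRegularity.NavierStokesRegularity.Theses.FilamentSkeletonRss
import Literature.Analysis.FluidPDE.PineauVicolRDSSLeray
import Literature.Analysis.FluidPDE.IsometryInvariance
import Literature.Analysis.FluidPDE.AncientSimilarityVariables
import Summits.NavierStokesRegularity.NavierStokesRegularity.Theorems.TypeICertificateLadderTargetSolitonLawsProfile

/-!
# Route FilamentSkeletonRss · crux `CoreGluing` (stmt-NavierStokesRegularity-15401) — line `Sketch`,
# stub `stub_classicalOfProfile`: from a rotated Leray profile to a classical solution on the past

Helper file (theorems only) for the skeleton `CoreGluing_of` of the crux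
`CoreGluing := SkeletonEquilibrium → RssProfileExists`. It proves the dictionary step (the converse
direction of the tree theorem `rss_profile_system`): a smooth solution `(U, P)` of Perelman's rotated
Leray profile system (Pineau–Vicol, arXiv:2607.09619, (1.8a–b); `J = rotGen = e₃ × ·`)

  `α(JU − DU[Jy]) + ½U + ½DU[y] − ΔU + DU[U] + ∇P = 0`, `∇·U = 0`,

with a bounded pressure `|P| ≤ M` yields, through the rotated self-similar ansatz
`u = pvAnsatz α U`, `u(t,x) = (−t)^{−1/2} R(αs) U(R(−αs) x/√(−t))`, `s = −log(−t)` (1.7), a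
classical Navier–Stokes solution (`ν = 1`, `f = 0`) on the time set `(−∞, 0)` with the pressure
`p(t,x) = (−t)⁻¹ P(R(−αs) x/√(−t))`, which is bounded by `M/(−t₀)` on every past slab `(−∞, t₀]`,
`t₀ < 0`.

Route of proof. In the tree's (rotation-free) backward similarity variables the ansatz field is the
physical field `ofLerayOrbit V` of the rotating profile `V(s, y) = R(αs) U(R(−αs) y)` with pressure
profile `Q(s, y) = P(R(−αs) y)` (definitionally), and `(ofLerayOrbit V, ofLerayOrbitPressure Q)` is a
classical solution on the past iff `(V, Q)` solves the backward Leray system on `ℝ × ℝ³`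
(`isClassicalNSSolutionOn_Iio_ofLerayOrbit_iff`). The latter is checked slice by slice: at time `s`
the pair `(V(s), Q(s))` is the conjugate of `(U, P)` by the linear isometry `R = rotZLIE (αs)`, so every
spatial term of Leray's momentum equation at `y` is `R` applied to the corresponding term for `U` at
`R⁻¹y` (`IsometryInvariance`), while `∂ₛV(s, y) = R(αs) · α(JU − DU[J·])(R(−αs) y)`
(`hasDerivAt_rotZ_conj_zero` and the group law of `rotZ`); the profile system is exactly what remains.
Joint smoothness of `(s, y) ↦ R(αs) U(R(−αs) y)` follows from
`R_θ v = v + sin θ • Jv + (1 − cos θ) • J(Jv)` (`rotZ_eq_add_sin_smul_rotGen`).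
-/

noncomputable section

-- the summit and its single sub-problem share the name (CONVENTIONS §1), as in every Theorems file
set_option linter.dupNamespace false

namespace Summit.NavierStokesRegularity.NavierStokesRegularity.Theorems

open Set Function Filter MeasureTheory
open Literature.Analysis.FluidPDE Literature.Analysis.FluidPDE.PineauVicol2026
open scoped RealInnerProductSpace Laplacian ContDiff Topology

/-- Joint smoothness of the rotation about the axis in the angle and the vector: if `θ : X → ℝ` and
`W : X → ℝ³` are `Cⁿ`, so is `z ↦ R_{θ(z)} W(z)` (from `R_θ v = v + sin θ • Jv + (1 − cos θ) • J(Jv)`,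
a sum of smooth scalar functions of `θ` times continuous linear maps of `v`). [folklore] -/
theorem classicalOfProfile_contDiff_rotZ {X : Type*} [NormedAddCommGroup X] [NormedSpace ℝ X]
    {n : WithTop ℕ∞} {θ : X → ℝ} {W : X → EuclideanSpace ℝ (Fin 3)}
    (hθ : ContDiff ℝ n θ) (hW : ContDiff ℝ n W) :
    ContDiff ℝ n (fun z => rotZ (θ z) (W z)) := by
  have e : (fun z => rotZ (θ z) (W z)) = fun z =>
      W z + Real.sin (θ z) • rotGenL (W z) + (1 - Real.cos (θ z)) • rotGenL (rotGenL (W z)) :=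
    funext fun z => rotZ_eq_add_sin_smul_rotGen _ _
  rw [e]
  have hJ : ContDiff ℝ n (fun z => rotGenL (W z)) := rotGenL.contDiff.comp hW
  have hJJ : ContDiff ℝ n (fun z => rotGenL (rotGenL (W z))) := rotGenL.contDiff.comp hJ
  exact (hW.add ((Real.contDiff_sin.comp hθ).smul hJ)).add
    ((contDiff_const.sub (Real.contDiff_cos.comp hθ)).smul hJJ)

/-- **The `s`-derivative of the rotating profile at every similarity time.** For `U`
differentiable, `d/ds [R(αs) U(R(−αs) y)] = R(αs) (α (J U(y') − DU(y')[J y']))` with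
`y' = R(−αs) y`: the case `s = 0` (`hasDerivAt_rotZ_conj_zero`) transported by the group law
`R(α s') = R(αs) R(α(s' − s))`. [folklore] -/
theorem classicalOfProfile_hasDerivAt_rotZ_conj
    {U : EuclideanSpace ℝ (Fin 3) → EuclideanSpace ℝ (Fin 3)} (hU : Differentiable ℝ U) (α s : ℝ)
    (y : EuclideanSpace ℝ (Fin 3)) :
    HasDerivAt (fun s' : ℝ => rotZ (α * s') (U (rotZ (-(α * s')) y)))
      (rotZ (α * s) (α • (rotGen (U (rotZ (-(α * s)) y)) -
        fderiv ℝ U (rotZ (-(α * s)) y) (rotGen (rotZ (-(α * s)) y))))) s := by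
  set y' := rotZ (-(α * s)) y with hy'
  have e : (fun s' : ℝ => rotZ (α * s') (U (rotZ (-(α * s')) y))) =
      fun s' => rotZL (α * s) (rotZ (α * (s' - s)) (U (rotZ (-(α * (s' - s))) y'))) := by
    funext s'
    simp only [rotZL_apply]
    rw [hy', ← rotZ_add, ← rotZ_add, show α * s + α * (s' - s) = α * s' by ring,
      show -(α * (s' - s)) + -(α * s) = -(α * s') by ring]
  rw [e]
  have h0 : HasDerivAt (fun h : ℝ => rotZ (α * h) (U (rotZ (-(α * h)) y')))
      (α • (rotGen (U y') - fderiv ℝ U y' (rotGen y'))) (s - s) := by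
    rw [sub_self]; exact hasDerivAt_rotZ_conj_zero hU α y'
  have h1 : HasDerivAt (fun s' : ℝ => rotZ (α * (s' - s)) (U (rotZ (-(α * (s' - s))) y')))
      (α • (rotGen (U y') - fderiv ℝ U y' (rotGen y'))) s := h0.comp_sub_const s s
  have h2 := (rotZL (α * s)).hasFDerivAt.comp_hasDerivAt s h1
  simpa only [Function.comp_def, rotZL_apply] using h2

/-- **Joint smoothness of the rotating profile**: for `U ∈ C^∞`, the field
`(s, y) ↦ R(αs) U(R(−αs) y)` is jointly smooth on `ℝ × ℝ³`. [folklore] -/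
theorem classicalOfProfile_isSmoothSpaceTimeOn_velocity {α : ℝ}
    {U : EuclideanSpace ℝ (Fin 3) → EuclideanSpace ℝ (Fin 3)} (hU : ContDiff ℝ ∞ U) :
    IsSmoothSpaceTimeOn univ (fun (s : ℝ) (y : EuclideanSpace ℝ (Fin 3)) =>
      rotZ (α * s) (U (rotZ (-(α * s)) y))) := by
  have hθ : ContDiff ℝ ∞ (fun z : ℝ × EuclideanSpace ℝ (Fin 3) => α * z.1) :=
    contDiff_const.mul contDiff_fst
  have hin : ContDiff ℝ ∞ (fun z : ℝ × EuclideanSpace ℝ (Fin 3) => rotZ (-(α * z.1)) z.2) :=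
    classicalOfProfile_contDiff_rotZ hθ.neg contDiff_snd
  have hV : ContDiff ℝ ∞ (fun z : ℝ × EuclideanSpace ℝ (Fin 3) =>
      rotZ (α * z.1) (U (rotZ (-(α * z.1)) z.2))) :=
    classicalOfProfile_contDiff_rotZ hθ (hU.comp hin)
  exact hV.contDiffOn

/-- **Joint smoothness of the rotating pressure profile**: for `P ∈ C^∞`, the scalar field
`(s, y) ↦ P(R(−αs) y)` is jointly smooth on `ℝ × ℝ³`. [folklore] -/
theorem classicalOfProfile_isSmoothSpaceTimeOn_pressure {α : ℝ}
    {P : EuclideanSpace ℝ (Fin 3) → ℝ} (hP : ContDiff ℝ ∞ P) :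
    IsSmoothSpaceTimeOn univ (fun (s : ℝ) (y : EuclideanSpace ℝ (Fin 3)) => P (rotZ (-(α * s)) y)) := by
  have hθ : ContDiff ℝ ∞ (fun z : ℝ × EuclideanSpace ℝ (Fin 3) => α * z.1) :=
    contDiff_const.mul contDiff_fst
  have hin : ContDiff ℝ ∞ (fun z : ℝ × EuclideanSpace ℝ (Fin 3) => rotZ (-(α * z.1)) z.2) :=
    classicalOfProfile_contDiff_rotZ hθ.neg contDiff_snd
  exact (hP.comp hin).contDiffOn

/-- **Leray's momentum equation for the rotating profile.** If `(U, P)` solves the rotated profile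
system `α(JU − DU[Jy]) + ½U + ½DU[y] − ΔU + DU[U] + ∇P = 0`, then `V(s, y) = R(αs) U(R(−αs) y)`,
`Q(s, y) = P(R(−αs) y)` satisfy `∂ₛV + ½V + ½DV[y] + DV[V] + ∇Q = ΔV` at every `(s, y)`: each
spatial term at `y` is `R(αs)` applied to the corresponding term for `(U, P)` at `R(−αs) y`
(rotation covariance, `IsometryInvariance`), and `∂ₛV` is `R(αs)` applied to `α(JU − DU[J·])`
there. [cite: PineauVicol2026, (1.7)–(1.8) (arXiv:2607.09619 p. 3)] -/
theorem classicalOfProfile_momentum {α : ℝ}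
    {U : EuclideanSpace ℝ (Fin 3) → EuclideanSpace ℝ (Fin 3)} {P : EuclideanSpace ℝ (Fin 3) → ℝ}
    (hU : ContDiff ℝ ∞ U)
    (heq : ∀ y : EuclideanSpace ℝ (Fin 3), α • (rotGen (U y) - fderiv ℝ U y (rotGen y)) +
      (1 / 2 : ℝ) • U y + (1 / 2 : ℝ) • fderiv ℝ U y y - (Δ U) y + fderiv ℝ U y (U y) +
      gradient P y = 0)
    (s : ℝ) (y : EuclideanSpace ℝ (Fin 3)) :
    timeDerivWithin univ (fun (s' : ℝ) (y' : EuclideanSpace ℝ (Fin 3)) =>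
        rotZ (α * s') (U (rotZ (-(α * s')) y'))) s y +
      (1 / 2 : ℝ) • rotZ (α * s) (U (rotZ (-(α * s)) y)) +
      (1 / 2 : ℝ) • fderiv ℝ (fun y' => rotZ (α * s) (U (rotZ (-(α * s)) y'))) y y +
      convect (fun y' => rotZ (α * s) (U (rotZ (-(α * s)) y')))
        (fun y' => rotZ (α * s) (U (rotZ (-(α * s)) y'))) y +
      gradient (fun y' => P (rotZ (-(α * s)) y')) y =
    (1 : ℝ) • (Δ (fun y' => rotZ (α * s) (U (rotZ (-(α * s)) y')))) y := by
  set R : EuclideanSpace ℝ (Fin 3) ≃ₗᵢ[ℝ] EuclideanSpace ℝ (Fin 3) := rotZLIE (α * s) with hR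
  set y' : EuclideanSpace ℝ (Fin 3) := rotZ (-(α * s)) y with hy'def
  have hy' : R.symm y = y' := rfl
  have hUd : Differentiable ℝ U := hU.differentiable (by simp)
  -- the time derivative
  have htd : timeDerivWithin univ (fun (s' : ℝ) (y' : EuclideanSpace ℝ (Fin 3)) =>
      rotZ (α * s') (U (rotZ (-(α * s')) y'))) s y =
      R (α • (rotGen (U y') - fderiv ℝ U y' (rotGen y'))) := by
    rw [timeDerivWithin_apply, derivWithin_univ]
    exact (classicalOfProfile_hasDerivAt_rotZ_conj hUd α s y).deriv
  -- the spatial terms (rotation covariance)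
  have hD : fderiv ℝ (fun z => R (U (R.symm z))) y y = R (fderiv ℝ U y' y') := by
    rw [fderiv_conj_linearIsometryEquiv, hy']
    rfl
  have hC : convect (fun z => R (U (R.symm z))) (fun z => R (U (R.symm z))) y =
      R (fderiv ℝ U y' (U y')) := by
    rw [convect_conj_linearIsometryEquiv, convect_apply, hy']
  have hG : gradient (fun z => P (R.symm z)) y = R (gradient P y') := by
    rw [gradient_comp_linearIsometryEquiv_symm, hy']
  have hL : (Δ fun z => R (U (R.symm z))) y = R ((Δ U) y') := by
    rw [laplacian_conj_linearIsometryEquiv, hy']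
  -- the profile system, rearranged
  have key : α • (rotGen (U y') - fderiv ℝ U y' (rotGen y')) + (1 / 2 : ℝ) • U y' +
      (1 / 2 : ℝ) • fderiv ℝ U y' y' + fderiv ℝ U y' (U y') + gradient P y' = (Δ U) y' := by
    rw [← sub_eq_zero, ← heq y']
    abel
  show timeDerivWithin univ (fun (s' : ℝ) (y' : EuclideanSpace ℝ (Fin 3)) =>
        rotZ (α * s') (U (rotZ (-(α * s')) y'))) s y +
      (1 / 2 : ℝ) • R (U y') + (1 / 2 : ℝ) • fderiv ℝ (fun z => R (U (R.symm z))) y y +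
      convect (fun z => R (U (R.symm z))) (fun z => R (U (R.symm z))) y +
      gradient (fun z => P (R.symm z)) y = (1 : ℝ) • (Δ fun z => R (U (R.symm z))) y
  rw [htd, hD, hC, hG, hL, one_smul, ← key]
  simp only [map_add, LinearIsometryEquiv.map_smul]

/-- **The rotating profile solves the backward Leray system.** For a smooth solution `(U, P)` of
the rotated profile system with `∇·U = 0`, the pair `V(s, y) = R(αs) U(R(−αs) y)`,
`Q(s, y) = P(R(−αs) y)` is a classical solution of the backward Leray system (`ν = 1`) on
`ℝ × ℝ³`. [cite: PineauVicol2026, (1.7)–(1.8) (arXiv:2607.09619 p. 3)] -/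
theorem classicalOfProfile_isBackwardLeraySolutionOn {α : ℝ}
    {U : EuclideanSpace ℝ (Fin 3) → EuclideanSpace ℝ (Fin 3)} {P : EuclideanSpace ℝ (Fin 3) → ℝ}
    (hU : ContDiff ℝ ∞ U) (hP : ContDiff ℝ ∞ P) (hdiv : VectorCalculus.IsDivFree U)
    (heq : ∀ y : EuclideanSpace ℝ (Fin 3), α • (rotGen (U y) - fderiv ℝ U y (rotGen y)) +
      (1 / 2 : ℝ) • U y + (1 / 2 : ℝ) • fderiv ℝ U y y - (Δ U) y + fderiv ℝ U y (U y) +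
      gradient P y = 0) :
    IsBackwardLeraySolutionOn univ 1
      (fun (s : ℝ) (y : EuclideanSpace ℝ (Fin 3)) => rotZ (α * s) (U (rotZ (-(α * s)) y)))
      (fun (s : ℝ) (y : EuclideanSpace ℝ (Fin 3)) => P (rotZ (-(α * s)) y)) := by
  refine IsBackwardLeraySolutionOn.of_leray (classicalOfProfile_isSmoothSpaceTimeOn_velocity hU)
    (classicalOfProfile_isSmoothSpaceTimeOn_pressure hP)
    (fun s _ y => classicalOfProfile_momentum hU heq s y) fun s _ => ?_
  simpa only [rotZLIE_apply, rotZLIE_symm_apply] using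
    hdiv.conj_linearIsometryEquiv (rotZLIE (α * s))

/-- **Stub 2 (dictionary: profile ⇒ classical solution on the past).** A smooth solution `(U, P)` of the
rotated Leray profile system with bounded pressure gives, through the Pineau–Vicol ansatz
`u = pvAnsatz α U`, a classical Navier–Stokes solution (`ν = 1`, `f = 0`) on the time set `(−∞, 0)` with
some pressure `p` bounded on every past slab `(−∞, t]`, `t < 0` (namely
`p(t, x) = (−t)⁻¹ P(R(−αs) x/√(−t))`, `s = −log(−t)`, bounded there by `M/(−t)`).
[cite: PineauVicol2026, (1.7)–(1.8) (arXiv:2607.09619 p. 3)] -/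
theorem stub_classicalOfProfile :
    ∀ (α M : ℝ) (U : EuclideanSpace ℝ (Fin 3) → EuclideanSpace ℝ (Fin 3)) (P : EuclideanSpace ℝ (Fin 3) → ℝ),
      ContDiff ℝ (⊤ : ℕ∞) U → ContDiff ℝ (⊤ : ℕ∞) P → VectorCalculus.IsDivFree U →
      (∀ y : EuclideanSpace ℝ (Fin 3), α • (rotGen (U y) - fderiv ℝ U y (rotGen y)) + (1 / 2 : ℝ) • U y +
        (1 / 2 : ℝ) • fderiv ℝ U y y - (Δ U) y + fderiv ℝ U y (U y) + gradient P y = 0) →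
      (∀ y : EuclideanSpace ℝ (Fin 3), |P y| ≤ M) →
      ∃ p : ℝ → EuclideanSpace ℝ (Fin 3) → ℝ,
        IsClassicalNSSolutionOn (Iio 0) 1 0 (pvAnsatz α (fun y _ => U y)) p ∧
        ∀ t < 0, IsBoundedOn (Iic t) p := by
  intro α M U P hU hP hdiv heq hPM
  have hL := classicalOfProfile_isBackwardLeraySolutionOn (α := α) hU hP hdiv heq
  have hNS := isClassicalNSSolutionOn_Iio_ofLerayOrbit_iff.2 hL
  refine ⟨ofLerayOrbitPressure fun (s : ℝ) (y : EuclideanSpace ℝ (Fin 3)) => P (rotZ (-(α * s)) y),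
    ?_, fun t ht => ?_⟩
  · have e : pvAnsatz α (fun y _ => U y) = ofLerayOrbit
        (fun (s : ℝ) (y : EuclideanSpace ℝ (Fin 3)) => rotZ (α * s) (U (rotZ (-(α * s)) y))) := by
      funext t x
      rfl
    rw [e]
    exact hNS
  · have h0 : 0 < -t := neg_pos.2 ht
    refine ⟨(-t)⁻¹ * M, fun t' ht' x => ?_⟩
    have h1 : -t ≤ -t' := neg_le_neg ht'
    have h2 : 0 < -t' := h0.trans_le h1
    rw [ofLerayOrbitPressure_apply, norm_mul, norm_inv, Real.norm_eq_abs, Real.norm_eq_abs,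
      abs_of_pos h2]
    exact mul_le_mul (inv_anti₀ h0 h1) (hPM _) (abs_nonneg _) (inv_nonneg.2 h0.le)

end Summit.NavierStokesRegularity.NavierStokesRegularity.Theorems

end
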